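import Mathlib
import Summits.ValiantsHypothesis.ValiantsHypothesis.Theorems.RigidityForcesSymmetryRankRigidMinimalReprLaplaceFiveSectorSplitDefs

/-!
# ValiantsHypothesis / RigidityForcesSymmetry — crux `LaplaceOptimalFive` (stmt-ValiantsHypothesis-24813), crux idea
`separated-capture` (val-idea-19 g8): SEPARATED-PROFILE ELIMINATION and the 3-slot CAPTURE INEQUALITY — part 1/3, DEFINITIONS
and the coordinate machinery

PORT of the crux workfile `Cruxes/LaplaceOptimalFive/SeparatedCaptureSketch.lean` r4 (sha16 b3584f027d45cbd3, 817 l., farm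
rc 0 / 0 sorry) — proof texts VERBATIM; namespace `…Cruxes.LaplaceOptimalFive.SeparatedCapture` ↦
`…Theorems.RigidityForcesSymmetryRankRigidMinimalRepr.LaplaceFiveSeparatedCapture`; split by the 400-line cap into
`…SeparatedCaptureDefs` (vocabulary + coordinate machinery) → `…SeparatedCapture` (the two forward lemmas) →
`…SeparatedCaptureViolation` (the converse construction + the glue to the Theses decl); DEDUP: the sketch's `weight` is
byte-identical to ✓ `LaplaceFiveSectorSplit.laplaceWeight` and is replaced by it (import, two `unfold`s renamed) — nothing else of
the landed `…LaplaceFive*` files is restated (`Cylindrical` = conjuncts 1–2 of `IsSplitDecomposition`, kept as the sketch's own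
hypothesis shape).

THIS MODULE.  A split profile of `Fin 5` is SEPARATED along `Z | Zᶜ` when every short side lies inside `Z` or inside `Zᶜ`; for
`Z = {3,4}` these are the profiles K₃ ⊔ K₂ = {01, 02, 12, 34} and sub-supports (`SepProfile34`).  Vocabulary: `Cylindrical` (the two
cylinder conditions), `perm5` (`P₅ = [v injective]`), `word`, the OBLIGATION TENSOR `contractZ μ = P₅ ⌞ μ`, the triangle
configuration space `L3 U₀₁ U₀₂ U₁₂`, ★ `CaptureIneq` (the 3-slot capture inequality: a triangle configuration of total dimension
`m = m₀₁ + m₀₂ + m₁₂` captures at most `m` independent symmetric zero-diagonal obligations), `short2`, `SepProfile34`, `shortSpan`; then the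
coordinates for the converse construction: `P` (ordered pairs), `Lsym`, `xT`, the `{3,4} | {0,1,2}` Laplace identity `laplace34`,
`nu`/`nuL` (injective on symmetric zero-diagonal matrices: `eq_zero_of_nu`, `nu_basis_linearIndependent`), the regrouping map `Phi`
with `L3_le_range`, `Lsym_lincomb`.  Parts 2/3: `…SeparatedCapture` (obligations are captured; `CaptureIneq` ⇒ the crux on every
{3,4}-separated pair profile) and `…SeparatedCaptureViolation` (`¬ CaptureIneq` ⇒ an honest weight-≤-108 separated system ⇒
`¬ LaplaceOptimalFive`).

Honest framing.  CONDITIONAL helper rows / an INSTRUMENT for an OPEN crux: `CaptureIneq` itself is OPEN; `LaplaceOptimalFive`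
(stmt-ValiantsHypothesis-24813, OPEN · CONTESTED 72/120), `RankRigidMinimalRepr`, `VP ≠ VNP` are NOT proved; no summit statement is
proved by this port.  Credit: statements + proofs val-idea-19 g8 (crux idea #8 `separated-capture`, card
`Cruxes/LaplaceOptimalFive/Ideas/separated-capture.md`, referee val-idea-crit-3 g5); port val-port-4 g3 (desk RULING #358 (A)).
-/

set_option linter.dupNamespace false

namespace Summit.ValiantsHypothesis.ValiantsHypothesis.Theorems.RigidityForcesSymmetryRankRigidMinimalRepr

namespace LaplaceFiveSeparatedCapture

open Finset LaplaceFiveSectorSplit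

/-! ### Vocabulary (as in `Lines/shallow_collision.lean`; the Laplace weight is ✓ `LaplaceFiveSectorSplit.laplaceWeight`) -/

/-- The two cylinder conditions of `LaplaceOptimal 5` for a term system `(S, u, w)`. -/
def Cylindrical {N : ℕ} (S : Fin N → Finset (Fin 5)) (u w : Fin N → (Fin 5 → Fin 5) → ℂ) : Prop :=
  (∀ t, ∀ v v' : Fin 5 → Fin 5, (∀ i ∈ S t, v i = v' i) → u t v = u t v') ∧
  (∀ t, ∀ v v' : Fin 5 → Fin 5, (∀ i, i ∉ S t → v i = v' i) → w t v = w t v')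

/-! ### New objects -/

/-- The 5 × 5 permutation pattern `P₅ = [v injective]` (the right-hand side of the crux). -/
def perm5 (v : Fin 5 → Fin 5) : ℂ := if Function.Injective v then 1 else 0

/-- The word with letters `p q r` on the triangle slots `0 1 2` and `s t` on the leaf slots `3 4`. -/
def word (p q r s t : Fin 5) : Fin 5 → Fin 5 := ![p, q, r, s, t]

/-- OBLIGATION TENSOR `T_μ := P₅ ⌞ μ`: contraction of `P₅` against a leaf matrix `μ` on slots `{3,4}`.  On injective
triples `(p,q,r)` it equals `μ s t + μ t s` with `{s,t} = {p,q,r}ᶜ`; it vanishes on non-injective triples.  Linear in `μ`,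
blind to the antisymmetric and diagonal parts of `μ`. -/
def contractZ (μ : Fin 5 → Fin 5 → ℂ) : Fin 5 → Fin 5 → Fin 5 → ℂ :=
  fun p q r => ∑ s : Fin 5, ∑ t : Fin 5, μ s t * perm5 (word p q r s t)

/-- TRIANGLE CONFIGURATION SPACE `L₃(U₀₁,U₀₂,U₁₂) = U₀₁ ⊗ V₂ + U₀₂ ⊗ V₁ + U₁₂ ⊗ V₀ ⊂ (ℂ⁵)^{⊗3}` (3-tensors written as
functions `p q r ↦ T p q r` on slots `0 1 2`). -/
def L3 (U01 U02 U12 : Submodule ℂ (Fin 5 → Fin 5 → ℂ)) : Submodule ℂ (Fin 5 → Fin 5 → Fin 5 → ℂ) :=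
  Submodule.span ℂ
    ({T | ∃ u ∈ U01, ∃ y : Fin 5 → ℂ, T = fun p q r => u p q * y r} ∪
     {T | ∃ u ∈ U02, ∃ y : Fin 5 → ℂ, T = fun p q r => u p r * y q} ∪
     {T | ∃ u ∈ U12, ∃ y : Fin 5 → ℂ, T = fun p q r => u q r * y p})

/-- THE 3-SLOT CAPTURE INEQUALITY (pair version).  `W` ranges over spaces of symmetric zero-diagonal leaf matrices
(≅ subspaces of ℂ¹⁰ = functions on 3-subsets, via complement); if every obligation `T_μ, μ ∈ W` is captured by the
triangle configuration then `dim W ≤ m₀₁ + m₀₂ + m₁₂`.  Tight for the two Laplace configurations (all ten pair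
indicators on one direction; cf. the docstring table in the card), NOT unit-incremental (one added form can raise the
captured dimension by 3), so any proof is global.  Equivalent to `LaplaceOptimalFive` on {3,4}-separated pair profiles
(`stub_separated_of_capture` + `stub_violation_refutes`). -/
def CaptureIneq : Prop :=
  ∀ (U01 U02 U12 W : Submodule ℂ (Fin 5 → Fin 5 → ℂ)),
    (∀ μ ∈ W, ∀ s t : Fin 5, μ s t = μ t s) → (∀ μ ∈ W, ∀ s : Fin 5, μ s s = 0) →
    (∀ μ ∈ W, contractZ μ ∈ L3 U01 U02 U12) →
    Module.finrank ℂ W ≤ Module.finrank ℂ U01 + Module.finrank ℂ U02 + Module.finrank ℂ U12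

/-- Short factor of a term as a 5 × 5 matrix on the slot pair `(a, b)` (filler letter `0` elsewhere; by cylindricity the
filler is irrelevant). -/
def short2 (f : (Fin 5 → Fin 5) → ℂ) (a b : Fin 5) : Fin 5 → Fin 5 → ℂ :=
  fun p q => f (Function.update (Function.update (fun _ => (0 : Fin 5)) a p) b q)

/-- {3,4}-SEPARATED PAIR PROFILE, normalised so that `S t` is the 2-element (short, `u`-) side: the triangle cuts
`01, 02, 12` and the leaf cut `34`.  (A term filed with `S t = {0,1,2}` etc. is the same cut with `u, w` swapped.) -/
def SepProfile34 {N : ℕ} (T : Finset (Fin N)) (S : Fin N → Finset (Fin 5)) : Prop :=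
  ∀ t ∈ T, S t = ({0, 1} : Finset (Fin 5)) ∨ S t = ({0, 2} : Finset (Fin 5)) ∨
    S t = ({1, 2} : Finset (Fin 5)) ∨ S t = ({3, 4} : Finset (Fin 5))

/-- Span of the short factors of the terms on the cut with short side `{a, b}`. -/
def shortSpan {N : ℕ} (T : Finset (Fin N)) (S : Fin N → Finset (Fin 5)) (u : Fin N → (Fin 5 → Fin 5) → ℂ)
    (a b : Fin 5) : Submodule ℂ (Fin 5 → Fin 5 → ℂ) :=
  Submodule.span ℂ ((fun t => short2 (u t) a b) '' {t : Fin N | t ∈ T ∧ S t = ({a, b} : Finset (Fin 5))})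

/-! ### Machinery for the converse construction (`stub_violation_honest`): coordinates on the ten leaf obligations,
the {3,4} | {0,1,2} Laplace identity, capture unpacking over bases, and the adapted basis of `ℂ¹⁰`. -/

/-- ordered pairs `s < t` (≅ the ten leaf obligations / 3-subsets by complement) -/
abbrev P := {x : Fin 5 × Fin 5 // x.1 < x.2}

/-- There are ten ordered pairs `s < t` in `Fin 5`. -/
lemma card_P : Fintype.card P = 10 := by decide

/-- the symmetric zero-diagonal matrix with upper-triangular coordinates `c` -/
def Lsym (c : P → ℂ) (s t : Fin 5) : ℂ :=
  if h : s < t then c ⟨(s, t), h⟩ else if h' : t < s then c ⟨(t, s), h'⟩ else 0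

/-- `Lsym` is additive. -/
lemma Lsym_add (c c' : P → ℂ) : Lsym (c + c') = Lsym c + Lsym c' := by
  funext s t; simp only [Lsym, Pi.add_apply]; split_ifs <;> simp
/-- `Lsym` commutes with scalars. -/
lemma Lsym_smul (r : ℂ) (c : P → ℂ) : Lsym (r • c) = r • Lsym c := by
  funext s t; simp only [Lsym, Pi.smul_apply, smul_eq_mul]; split_ifs <;> simp
/-- `Lsym` commutes with finite sums. -/
lemma Lsym_sum {ι : Type*} (s : Finset ι) (c : ι → P → ℂ) :
    Lsym (∑ i ∈ s, c i) = ∑ i ∈ s, Lsym (c i) := by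
  classical
  induction s using Finset.induction_on with
  | empty => funext a b; simp [Lsym]
  | insert i s hi ih => rw [Finset.sum_insert hi, Finset.sum_insert hi, Lsym_add, ih]
/-- `Lsym c` is a symmetric matrix. -/
lemma Lsym_symm (c : P → ℂ) (s t : Fin 5) : Lsym c s t = Lsym c t s := by
  simp only [Lsym]
  rcases lt_trichotomy s t with h | rfl | h
  · simp [h, not_lt.mpr h.le]
  · simp
  · simp [h, not_lt.mpr h.le]
/-- `Lsym c` has zero diagonal. -/
lemma Lsym_diag (c : P → ℂ) (s : Fin 5) : Lsym c s s = 0 := by simp [Lsym]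

/-- the arrangement tensor of the obligation `π`: `x_π(p,q,r) = P₅(p,q,r,π₁,π₂)` -/
def xT (π : P) (p q r : Fin 5) : ℂ := perm5 (word p q r π.1.1 π.1.2)

/-- Swapping the two leaf letters is precomposition with the transposition `(3 4)`. -/
lemma word_swap (p q r s t : Fin 5) : word p q r t s = word p q r s t ∘ Equiv.swap (3 : Fin 5) 4 := by
  funext i
  fin_cases i <;> simp [word, Equiv.swap_apply_of_ne_of_ne]

/-- `P₅` is invariant under swapping the two leaf letters. -/
lemma perm5_swap (p q r s t : Fin 5) : perm5 (word p q r t s) = perm5 (word p q r s t) := by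
  unfold perm5
  rw [word_swap]
  by_cases h : Function.Injective (word p q r s t)
  · rw [if_pos h, if_pos (h.comp (Equiv.injective _))]
  · rw [if_neg h, if_neg]
    intro h'
    apply h
    have := h'.comp (Equiv.injective (Equiv.swap (3 : Fin 5) 4))
    simpa [Function.comp_assoc, ← Equiv.coe_trans, Equiv.swap_swap] using this

/-- `P₅` vanishes on a word with a repeated leaf letter. -/
lemma perm5_rep (p q r s : Fin 5) : perm5 (word p q r s s) = 0 := by
  unfold perm5
  rw [if_neg]
  intro h
  have := @h 3 4 (by simp [word])
  exact absurd this (by decide)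

/-- the {3,4} | {0,1,2} Laplace identity in coordinates -/
lemma laplace34 (p q r s t : Fin 5) :
    perm5 (word p q r s t) = ∑ π : P, xT π p q r * Lsym (Pi.single π 1) s t := by
  rcases lt_trichotomy s t with h | rfl | h
  · have : ∀ π : P, xT π p q r * Lsym (Pi.single π 1) s t
        = if π = ⟨(s, t), h⟩ then perm5 (word p q r s t) else 0 := by
      intro π
      simp only [Lsym, h, dif_pos, Pi.single_apply]
      split_ifs with h1 h2 h2
      · subst h2; simp [xT]
      · exact absurd h1.symm h2
      · exact absurd h2.symm h1
      · simp
    rw [Finset.sum_congr rfl (fun π _ => this π), Finset.sum_ite_eq']; simp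
  · simp [perm5_rep, Lsym_diag]
  · have : ∀ π : P, xT π p q r * Lsym (Pi.single π 1) s t
        = if π = ⟨(t, s), h⟩ then perm5 (word p q r s t) else 0 := by
      intro π
      simp only [Lsym, h, not_lt.mpr h.le, dif_pos, dif_neg, Pi.single_apply, not_false_eq_true]
      split_ifs with h1 h2 h2
      · subst h2; simp [xT, perm5_swap]
      · exact absurd h1.symm h2
      · exact absurd h2.symm h1
      · simp
    rw [Finset.sum_congr rfl (fun π _ => this π), Finset.sum_ite_eq']; simp

/-- obligation functional coordinates: `ν μ π = Σ_{s,t} μ s t · y_π(s,t)` (= `μ π₁ π₂ + μ π₂ π₁`) -/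
def nu (μ : Fin 5 → Fin 5 → ℂ) (π : P) : ℂ := ∑ s : Fin 5, ∑ t : Fin 5, μ s t * Lsym (Pi.single π 1) s t

/-- The obligation tensor expands over the pair coordinates: `T_μ = Σ_π ν(μ)_π · x_π`. -/
lemma contractZ_expand (μ : Fin 5 → Fin 5 → ℂ) (p q r : Fin 5) :
    contractZ μ p q r = ∑ π : P, nu μ π * xT π p q r := by
  unfold contractZ nu
  simp_rw [laplace34, Finset.mul_sum, Finset.sum_mul]
  calc (∑ s : Fin 5, ∑ t : Fin 5, ∑ π : P, μ s t * (xT π p q r * Lsym (Pi.single π 1) s t))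
      = ∑ s : Fin 5, ∑ π : P, ∑ t : Fin 5, μ s t * (xT π p q r * Lsym (Pi.single π 1) s t) := by
        refine Finset.sum_congr rfl fun s _ => Finset.sum_comm
    _ = ∑ π : P, ∑ s : Fin 5, ∑ t : Fin 5, μ s t * (xT π p q r * Lsym (Pi.single π 1) s t) := Finset.sum_comm
    _ = _ := by
        refine Finset.sum_congr rfl fun π _ => Finset.sum_congr rfl fun s _ => Finset.sum_congr rfl fun t _ => ?_
        ring

/-- The symmetric pair indicator `Lsym e_π` entrywise. -/
lemma Lsym_single_eq (π : P) (s t : Fin 5) :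
    Lsym (Pi.single π 1) s t
      = (if s = π.1.1 ∧ t = π.1.2 then (1:ℂ) else 0) + (if s = π.1.2 ∧ t = π.1.1 then 1 else 0) := by
  obtain ⟨⟨a, b⟩, hab⟩ := π
  simp only [Lsym, Pi.single_apply]
  rcases lt_trichotomy s t with h | rfl | h
  · simp only [h, dif_pos]
    have hne : ¬ (s = b ∧ t = a) := by rintro ⟨rfl, rfl⟩; exact lt_asymm h hab
    simp only [hne, if_false, add_zero]
    congr 1
    simp [Subtype.ext_iff, Prod.ext_iff]
  · have h1 : ¬ (s = a ∧ s = b) := by rintro ⟨rfl, rfl⟩; exact lt_irrefl _ hab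
    have h2 : ¬ (s = b ∧ s = a) := by rintro ⟨rfl, rfl⟩; exact lt_irrefl _ hab
    simp [h1, h2]
  · simp only [not_lt.mpr h.le, dif_neg, not_false_eq_true, h, dif_pos]
    have hne : ¬ (s = a ∧ t = b) := by rintro ⟨rfl, rfl⟩; exact lt_asymm h hab
    simp only [hne, if_false, zero_add]
    have hiff : (⟨(t, s), h⟩ : P) = ⟨(a, b), hab⟩ ↔ (s = b ∧ t = a) := by
      simp only [Subtype.ext_iff, Prod.ext_iff]
      constructor
      · rintro ⟨h1, h2⟩; exact ⟨h2, h1⟩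
      · rintro ⟨h1, h2⟩; exact ⟨h2, h1⟩
    by_cases hc : s = b ∧ t = a
    · rw [if_pos (hiff.2 hc), if_pos hc]
    · rw [if_neg (fun h' => hc (hiff.1 h')), if_neg hc]

/-- `ν(μ)_π = μ π₁ π₂ + μ π₂ π₁`. -/
lemma nu_apply (μ : Fin 5 → Fin 5 → ℂ) (π : P) : nu μ π = μ π.1.1 π.1.2 + μ π.1.2 π.1.1 := by
  unfold nu
  simp_rw [Lsym_single_eq, mul_add, Finset.sum_add_distrib]
  congr 1
  · rw [Finset.sum_eq_single π.1.1, Finset.sum_eq_single π.1.2]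
    · simp
    · intro t _ ht; simp [ht]
    · simp
    · intro s _ hs; simp [hs]
    · simp
  · rw [Finset.sum_eq_single π.1.2, Finset.sum_eq_single π.1.1]
    · simp
    · intro t _ ht; simp [ht]
    · simp
    · intro s _ hs; simp [hs]
    · simp

/-- `ν` kills exactly the non-(symmetric zero-diagonal) part: on symmetric zero-diagonal matrices it is injective -/
lemma eq_zero_of_nu (μ : Fin 5 → Fin 5 → ℂ) (hs : ∀ s t, μ s t = μ t s) (hd : ∀ s, μ s s = 0)
    (h : ∀ π, nu μ π = 0) : μ = 0 := by
  funext s t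
  rcases lt_trichotomy s t with hlt | rfl | hlt
  · have := h ⟨(s, t), hlt⟩
    rw [nu_apply] at this
    simp only at this
    rw [hs t s] at this
    have : 2 * μ s t = 0 := by linear_combination this
    simpa using this
  · simp [hd]
  · have := h ⟨(t, s), hlt⟩
    rw [nu_apply] at this
    simp only at this
    rw [hs t s] at this
    have : 2 * μ s t = 0 := by linear_combination this
    simpa using this

/-- regrouping map: long factors `g` over fixed short-factor families `b1 b2 b3` ↦ the triangle 3-tensor -/
def Phi {m1 m2 m3 : ℕ} (b1 : Fin m1 → Fin 5 → Fin 5 → ℂ) (b2 : Fin m2 → Fin 5 → Fin 5 → ℂ)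
    (b3 : Fin m3 → Fin 5 → Fin 5 → ℂ) :
    ((Fin m1 → Fin 5 → ℂ) × (Fin m2 → Fin 5 → ℂ) × (Fin m3 → Fin 5 → ℂ)) →ₗ[ℂ] (Fin 5 → Fin 5 → Fin 5 → ℂ) where
  toFun g := fun p q r => (∑ l, b1 l p q * g.1 l r) + (∑ l, b2 l p r * g.2.1 l q) + (∑ l, b3 l q r * g.2.2 l p)
  map_add' g g' := by
    funext p q r
    simp only [Prod.fst_add, Prod.snd_add, Pi.add_apply, mul_add, Finset.sum_add_distrib]
    ring
  map_smul' c g := by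
    funext p q r
    simp only [Prod.smul_fst, Prod.smul_snd, Pi.smul_apply, smul_eq_mul, RingHom.id_apply]
    ring_nf
    simp only [Finset.mul_sum]
    ring_nf

/-- The regrouping map `Phi` entrywise. -/
lemma Phi_apply {m1 m2 m3 : ℕ} (b1 : Fin m1 → Fin 5 → Fin 5 → ℂ) (b2 : Fin m2 → Fin 5 → Fin 5 → ℂ)
    (b3 : Fin m3 → Fin 5 → Fin 5 → ℂ) (g) (p q r : Fin 5) :
    Phi b1 b2 b3 g p q r = (∑ l, b1 l p q * g.1 l r) + (∑ l, b2 l p r * g.2.1 l q) + (∑ l, b3 l q r * g.2.2 l p) := rfl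

/-- A vector of a finite-dimensional subspace is the sum of its coordinates times the basis. -/
lemma coe_eq_sum_repr {m : ℕ} {U : Submodule ℂ (Fin 5 → Fin 5 → ℂ)} (b : Module.Basis (Fin m) ℂ U)
    {u : Fin 5 → Fin 5 → ℂ} (hu : u ∈ U) (p q : Fin 5) :
    u p q = ∑ l, b.repr ⟨u, hu⟩ l * (b l : Fin 5 → Fin 5 → ℂ) p q := by
  have h := congrArg (fun x : U => (x : Fin 5 → Fin 5 → ℂ) p q) (b.sum_repr ⟨u, hu⟩)
  simp only [Submodule.coe_sum, Submodule.coe_smul, Finset.sum_apply, Pi.smul_apply, smul_eq_mul] at h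
  exact h.symm

/-- `L3` of three subspaces lies in the range of the regrouping map `Phi` over their bases. -/
lemma L3_le_range {m1 m2 m3 : ℕ} (U01 U02 U12 : Submodule ℂ (Fin 5 → Fin 5 → ℂ))
    (b1 : Module.Basis (Fin m1) ℂ U01) (b2 : Module.Basis (Fin m2) ℂ U02) (b3 : Module.Basis (Fin m3) ℂ U12) :
    L3 U01 U02 U12 ≤ LinearMap.range (Phi (fun l => (b1 l : Fin 5 → Fin 5 → ℂ)) (fun l => (b2 l : Fin 5 → Fin 5 → ℂ))
      (fun l => (b3 l : Fin 5 → Fin 5 → ℂ))) := by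
  apply Submodule.span_le.2
  rintro T ((⟨u, hu, y, rfl⟩ | ⟨u, hu, y, rfl⟩) | ⟨u, hu, y, rfl⟩)
  · refine ⟨(fun l r => b1.repr ⟨u, hu⟩ l * y r, 0, 0), ?_⟩
    funext p q r
    rw [Phi_apply]
    simp only [Pi.zero_apply, mul_zero, Finset.sum_const_zero, add_zero]
    rw [coe_eq_sum_repr b1 hu p q, Finset.sum_mul]
    exact Finset.sum_congr rfl fun l _ => by ring
  · refine ⟨(0, fun l q => b2.repr ⟨u, hu⟩ l * y q, 0), ?_⟩
    funext p q r
    rw [Phi_apply]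
    simp only [Pi.zero_apply, mul_zero, Finset.sum_const_zero, add_zero, zero_add]
    rw [coe_eq_sum_repr b2 hu p r, Finset.sum_mul]
    exact Finset.sum_congr rfl fun l _ => by ring
  · refine ⟨(0, 0, fun l p => b3.repr ⟨u, hu⟩ l * y p), ?_⟩
    funext p q r
    rw [Phi_apply]
    simp only [Pi.zero_apply, mul_zero, Finset.sum_const_zero, zero_add]
    rw [coe_eq_sum_repr b3 hu q r, Finset.sum_mul]
    exact Finset.sum_congr rfl fun l _ => by ring

/-! ### Layer 3: a basis of `P → ℂ` whose first block is `ν` of a basis of `W` -/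

/-- `ν` as a linear map -/
def nuL : (Fin 5 → Fin 5 → ℂ) →ₗ[ℂ] (P → ℂ) where
  toFun μ := fun π => nu μ π
  map_add' μ μ' := by funext π; simp [nu, add_mul, Finset.sum_add_distrib]
  map_smul' c μ := by funext π; simp [nu, Finset.mul_sum, mul_assoc]

/-- `nuL` is `ν` as a linear map. -/
lemma nuL_apply (μ : Fin 5 → Fin 5 → ℂ) (π : P) : nuL μ π = nu μ π := rfl

/-- linear independence of `ν ∘ (basis of W)` for a symmetric zero-diagonal `W` -/
lemma nu_basis_linearIndependent (W : Submodule ℂ (Fin 5 → Fin 5 → ℂ))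
    (hWs : ∀ μ ∈ W, ∀ s t : Fin 5, μ s t = μ t s) (hWd : ∀ μ ∈ W, ∀ s : Fin 5, μ s s = 0)
    {k : ℕ} (bW : Module.Basis (Fin k) ℂ W) :
    LinearIndependent ℂ (fun i => nuL (bW i : Fin 5 → Fin 5 → ℂ)) := by
  rw [Fintype.linearIndependent_iff]
  intro c hc i
  -- the combination `Σ c_i bW i` is an element of `W` killed by `ν`
  set μ : W := ∑ j, c j • bW j with hμ
  have hnu : ∀ π, nu (μ : Fin 5 → Fin 5 → ℂ) π = 0 := by
    intro π
    have := congr_fun hc π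
    simp only [Finset.sum_apply, Pi.smul_apply, smul_eq_mul, Pi.zero_apply] at this
    rw [hμ, Submodule.coe_sum]
    simp only [Submodule.coe_smul]
    have hlin : nu (∑ j, c j • (bW j : Fin 5 → Fin 5 → ℂ)) π = ∑ j, c j * nu (bW j : Fin 5 → Fin 5 → ℂ) π := by
      have := congr_fun (map_sum nuL (fun j => c j • (bW j : Fin 5 → Fin 5 → ℂ)) Finset.univ) π
      simp only [map_smul, Finset.sum_apply, Pi.smul_apply, smul_eq_mul, nuL_apply] at this
      exact this
    rw [hlin]
    simpa [nuL_apply] using this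
  have hμ0 : (μ : Fin 5 → Fin 5 → ℂ) = 0 :=
    eq_zero_of_nu _ (hWs _ μ.2) (hWd _ μ.2) hnu
  have hμ0' : μ = 0 := by ext1; simpa using hμ0
  have := Fintype.linearIndependent_iff.1 bW.linearIndependent c (by rw [← hμ]; exact hμ0') i
  exact this

/-- A function `Fin 5 → Fin 5` is the word of its values. -/
lemma word_eta (v : Fin 5 → Fin 5) : word (v 0) (v 1) (v 2) (v 3) (v 4) = v := by
  funext i; fin_cases i <;> rfl

/-- `Lsym` of a linear combination, entrywise. -/
lemma Lsym_lincomb {ι : Type*} [Fintype ι] (a : ι → ℂ) (c : ι → P → ℂ) (s t : Fin 5) :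
    (∑ J, a J * Lsym (c J) s t) = Lsym (fun π' => ∑ J, a J * c J π') s t := by
  have : (fun π' => ∑ J, a J * c J π') = ∑ J, a J • c J := by
    funext π'; simp [Finset.sum_apply, Pi.smul_apply]
  rw [this, Lsym_sum]
  simp only [Finset.sum_apply, Lsym_smul, Pi.smul_apply, smul_eq_mul]

end LaplaceFiveSeparatedCapture

end Summit.ValiantsHypothesis.ValiantsHypothesis.Theorems.RigidityForcesSymmetryRankRigidMinimalRepr
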